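import Literature.AnabelianGeometry.EtaleTheta.Discharge.Sec2Cor218AdmissibleAutDeltaStable
import Literature.AnabelianGeometry.AbsoluteAnabelian.MLFGaloisNoAbelianNormal
import HarnessLib

/-!
# [EtTh] Cor. 2.18 (i)/2.19 (iii): EVERY admissible automorphism of `Π^tp_X̲̲` is Δ-STABLE — the BARE form,
# «`Δ^tp_X` topologically finitely generated» NOT assumed (proof-only, generic in the §1 setting)

S. Mochizuki, *The Étale Theta Function and its Frobenioid-theoretic Manifestations* [EtTh], Publ. RIMS **45** (2009), §2
Cor. 2.18 (i) p. 60 / Cor. 2.19 (iii) p. 64 [cite: MochizukiEtTh2009, Cor 2.18 (i) p.60]; *Topics in Absolute Anabelian Geometry I*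
[AbsTopI] Thm 1.7 (ii) p. 14 (`G_k` elastic) [cite: MochizukiAbsTopI2012, Thm 1.7 (ii) p.14]; J. Neukirch, A. Schmidt, K. Wingberg,
*Cohomology of Number Fields* (2008), Ch. VII §5 [cite: NeukirchSchmidtWingberg2008, Ch. VII §5].  Cell `abc-iut`, K-L6 row
«COR219III-M1b» Δ-stability cell, seat abc-iut-L6-t19 (gen 11), self-named in-lineage row «DELTA-STABLE-BARE».  PROOF-ONLY: no
definition, no instance, no notation, no new named fact; consumed BY NAME — abc-iut-w5-d187's class-2 law
`commutator_commutator_aug_apply_eq_one`, closure lemma `commutator_commutator_eq_one_of_mem_topologicalClosure`, nilpotency lemma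
`isNilpotent_of_commutator_commutator_eq_one` (`Sec2Cor218AdmissibleAutDeltaStable`, p493789), `map_aug_Ydduu` (`DoubleUnderlineOfCocycle`:
`aug(Π^tp_Ÿ̲̲ ∩ Π^tp_X̲̲) = G_K`), and abc-iut-L6-t19
(gen 10)'s BARE Fitting-shape theorem `eq_bot_of_isNilpotent_of_normal_subgroupOf_of_isClosed` (`MLFGaloisNoAbelianNormal`, p497877:
`G_K`, `K/ℚ_p` finite, has no non-trivial CLOSED nilpotent subgroup normal in an open subgroup — topological finite generation is
automatic from `cd_ℓ(G_K) ≤ 2`, so it is no longer a hypothesis).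

WHAT IS SHOWN (any §1 setting `D : ThetaSetting p`, any `E`, any `X̲̲`-choice `C`, any level `l`).
**`aug_apply_eq_one_of_map_ker_toTheta_eq_bare`** — let `γ` be a bi-continuous automorphism of `Π^tp_X̲̲ = C.Huu` stabilising
`Ker(Π^tp_X̲̲ → (Π^tp_X)^Θ)` (clause (4) of Cor. 2.18 (i), the `hK` conjunct of abc-iut-C-hgal-2's `cor219_iii_of_hearts`).  THEN
`γ(Δ_X̲̲) ⊆ Δ_X̲̲`: `aug (γ g) = 1` for every `g ∈ Π^tp_X̲̲` with `aug g = 1` — with NO finite-generation hypothesis on `Δ_X̲̲` or `Δ^tp_X`.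
The proof is abc-iut-w5-d187's (p493789 §3) with its single use of topological finite generation removed: the closure `A` of
`aug(γ(Δ_X̲̲)) ⊆ G_K` is closed, satisfies the class-2 law `⁅⁅a,b⁆,c⁆ = 1` (hence is nilpotent) and is normal in the OPEN subgroup
`G_K = aug(Π^tp_X̲̲)` of `G_{ℚ_p}`; the bare theorem p497877 gives `A = ⊥` directly.
COROLLARIES: `map_ker_toTheta_comp_subtype_symm` (clause (4) passes to `γ⁻¹`), `mem_deltaTemp_apply_iff_of_map_ker_toTheta_eq`
(`γ g ∈ Δ^tp_X ↔ g ∈ Δ^tp_X`), `map_deltaTemp_subgroupOf_eq_of_map_ker_toTheta_eq` (`γ(Δ_X̲̲) = Δ_X̲̲` as subgroups of `Π^tp_X̲̲`) —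
so the displayed RESIDUAL of p493789 («generic settings carry `Δ^tp_X` topologically finitely generated») is GONE: its §5
model-level statement `aug_apply_eq_one_modelχq_of_map_ker_toTheta_eq` is now the generic case.
HONEST FRAMING: classical profinite group theory over OUR typed §1 interface; nothing of [EtTh] (refereed) is asserted or denied for a
curve; no side is taken on [IUTchIII] Cor. 3.12; typed ≠ proved; nothing here asserts abc proved or refuted.
-/

noncomputable section

namespace Literature.AnabelianGeometry.EtaleTheta

open Literature.AnabelianGeometry.SemiGraphs Literature.AnabelianGeometry.AbsoluteAnabelian _root_.Topology
open scoped commutatorElement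

namespace ThetaSetting.EtaleThetaData.DoubleUnderline

variable {p : ℕ} [Fact p.Prime] {D : ThetaSetting p} {E : D.EtaleThetaData} {l : ℕ}
  (C : E.DoubleUnderline l)

/-! ## §1 Δ-stability of admissible automorphisms — bare form -/

/-- **EVERY admissible automorphism of `Π^tp_X̲̲` is Δ-STABLE** (any §1 setting, any `X̲̲`-choice, NO finite-generation
hypothesis): if the bi-continuous automorphism `γ` of `Π^tp_X̲̲ = C.Huu` stabilises `Ker(Π^tp_X̲̲ → (Π^tp_X)^Θ)` (clause (4) of
[EtTh] Cor. 2.18 (i)), then `aug (γ g) = 1` for every `g ∈ Π^tp_X̲̲` with `aug g = 1`.  The closure of `aug(γ(Δ_X̲̲))` is a closed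
NILPOTENT subgroup of `G_{ℚ_p}` normal in the open subgroup `G_K = aug(Π^tp_X̲̲)`, hence trivial by abc-iut-L6-t19 (gen 10)'s bare
`eq_bot_of_isNilpotent_of_normal_subgroupOf_of_isClosed` (elasticity [AbsTopI] Thm 1.7 (ii) + slimness + `cd_ℓ(G_K) ≤ 2`).
[cite: MochizukiEtTh2009, Cor 2.18 (i) p.60] [cite: MochizukiAbsTopI2012, Thm 1.7 (ii) p.14] -/
theorem aug_apply_eq_one_of_map_ker_toTheta_eq_bare (γ : C.Huu ≃ₜ* C.Huu)
    (hK : (D.toTheta.comp C.Huu.subtype).ker.map γ.toMulEquiv.toMonoidHom = (D.toTheta.comp C.Huu.subtype).ker)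
    (g : C.Huu) (hg : D.aug.toMonoidHom (g : D.PiTemp) = 1) : D.aug.toMonoidHom ((γ g : C.Huu) : D.PiTemp) = 1 := by
  classical
  haveI := D.finiteDimensional_K
  -- the continuous homomorphism `φ := aug ∘ γ` on `Π^tp_X̲̲` and the image `N` of `Δ_X̲̲`
  set Δ : Subgroup C.Huu := D.DeltaTemp.subgroupOf C.Huu with hΔdef
  let φ : C.Huu →ₜ* GQp p :=
    { toMonoidHom := (D.aug.toMonoidHom.comp C.Huu.subtype).comp γ.toMulEquiv.toMonoidHom
      continuous_toFun := D.aug.continuous.comp (continuous_subtype_val.comp γ.continuous) }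
  have hφ : ∀ x : C.Huu, φ x = D.aug.toMonoidHom ((γ x : C.Huu) : D.PiTemp) := fun _ => rfl
  set N : Subgroup (GQp p) := Δ.map φ.toMonoidHom with hNdef
  set A : Subgroup (GQp p) := N.topologicalClosure with hAdef
  have hgΔ : g ∈ Δ := by rw [hΔdef, Subgroup.mem_subgroupOf]; exact (MonoidHom.mem_ker).2 hg
  -- it suffices that `A = ⊥`
  suffices hA : A = ⊥ by
    have hmem : φ g ∈ A := Subgroup.le_topologicalClosure _ ⟨g, hgΔ, rfl⟩
    rw [hA, Subgroup.mem_bot] at hmem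
    rwa [hφ] at hmem
  -- `G_K` is open and contains `N`, `A`
  have hGKo : IsOpen (D.GK : Set (GQp p)) := D.K.fixingSubgroup_isOpen
  have hφGK : ∀ x : C.Huu, φ x ∈ D.GK := fun x => by
    rw [hφ]
    have : D.aug.toMonoidHom ((γ x : C.Huu) : D.PiTemp) ∈ D.aug.toMonoidHom.range := ⟨_, rfl⟩
    rwa [D.range_aug] at this
  have hNGK : N ≤ D.GK := by
    rintro _ ⟨x, -, rfl⟩; exact hφGK x
  have hAGK : A ≤ D.GK :=
    N.topologicalClosure_minimal hNGK (Subgroup.isClosed_of_isOpen _ hGKo)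
  -- `N` is normalised by `G_K = aug(Π^tp_X̲̲)`
  have hNconj : ∀ h ∈ D.GK, ∀ n ∈ N, h * n * h⁻¹ ∈ N := by
    intro h hh n hn
    obtain ⟨δ, hδ, rfl⟩ := hn
    have hδ' : δ ∈ Δ := hδ
    -- lift `h` to `x ∈ Π^tp_X̲̲` (`aug(Π^tp_Ÿ̲̲) = G_K`), then through `γ`
    have hh' : h ∈ (D.GtpYdd ⊓ C.Huu).map D.aug.toMonoidHom := by rw [C.map_aug_Ydduu]; exact hh
    obtain ⟨x, hx, rfl⟩ := hh'
    set y : C.Huu := γ.symm ⟨x, (Subgroup.mem_inf.mp hx).2⟩ with hydef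
    have hγy : ((γ y : C.Huu) : D.PiTemp) = x := by
      rw [hydef, ContinuousMulEquiv.apply_symm_apply]
    have hmemΔ : y * δ * y⁻¹ ∈ Δ := by
      rw [hΔdef, Subgroup.mem_subgroupOf] at hδ' ⊢
      rw [Subgroup.coe_mul, Subgroup.coe_mul, Subgroup.coe_inv]
      exact (MonoidHom.normal_ker D.aug.toMonoidHom).conj_mem _ hδ' _
    refine ⟨y * δ * y⁻¹, hmemΔ, ?_⟩
    change φ (y * δ * y⁻¹) = D.aug.toMonoidHom x * φ δ * (D.aug.toMonoidHom x)⁻¹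
    rw [map_mul, map_mul, map_inv, hφ y, hγy]
  have hAconj : ∀ h ∈ D.GK, ∀ a ∈ A, h * a * h⁻¹ ∈ A := by
    intro h hh a ha
    have hcont : Continuous fun t : GQp p => h * t * h⁻¹ := by fun_prop
    have hmaps : Set.MapsTo (fun t : GQp p => h * t * h⁻¹) (N : Set (GQp p)) (N : Set (GQp p)) :=
      fun t ht => hNconj h hh t ht
    have ha' : a ∈ closure (N : Set (GQp p)) := ha
    exact map_mem_closure (f := fun t : GQp p => h * t * h⁻¹) hcont ha' hmaps
  have hAn : (A.subgroupOf D.GK).Normal := by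
    refine ⟨fun a ha h => ?_⟩
    rw [Subgroup.mem_subgroupOf] at ha ⊢
    rw [Subgroup.coe_mul, Subgroup.coe_mul, Subgroup.coe_inv]
    exact hAconj _ h.2 _ ha
  -- `A` satisfies the class-2 law, hence is nilpotent
  have hNlaw : ∀ a ∈ N, ∀ b ∈ N, ∀ c ∈ N, ⁅⁅a, b⁆, c⁆ = (1 : GQp p) := by
    rintro _ ⟨x, hx, rfl⟩ _ ⟨y, hy, rfl⟩ _ ⟨z, hz, rfl⟩
    have hx' : x ∈ Δ := hx
    have hy' : y ∈ Δ := hy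
    have hz' : z ∈ Δ := hz
    rw [hΔdef, Subgroup.mem_subgroupOf] at hx' hy' hz'
    exact C.commutator_commutator_aug_apply_eq_one γ hK ((MonoidHom.mem_ker).1 hx') ((MonoidHom.mem_ker).1 hy')
      ((MonoidHom.mem_ker).1 hz')
  have hAlaw := commutator_commutator_eq_one_of_mem_topologicalClosure N hNlaw
  have hcoeA : ∀ u v : A, ((⁅u, v⁆ : A) : GQp p) = ⁅(u : GQp p), (v : GQp p)⁆ := fun u v => by
    simp only [commutatorElement_def, Subgroup.coe_mul, Subgroup.coe_inv]
  have hAnil : Group.IsNilpotent A :=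
    isNilpotent_of_commutator_commutator_eq_one fun a b c => Subtype.ext (by
      rw [hcoeA, hcoeA, OneMemClass.coe_one]
      exact hAlaw _ a.2 _ b.2 _ c.2)
  have hAc : IsClosed (A : Set (GQp p)) := Subgroup.isClosed_topologicalClosure _
  -- the bare Fitting-shape theorem for `G_K ⊆ G_{ℚ_p}` (abc-iut-L6-t19 gen 10, p497877): `A = ⊥`, no tfg input
  exact eq_bot_of_isNilpotent_of_normal_subgroupOf_of_isClosed p ℚ_[p] D.GK A hGKo hAGK hAn hAc hAnil

/-! ## §2 Corollaries: clause (4) passes to `γ⁻¹`; `γ(Δ_X̲̲) = Δ_X̲̲` -/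

/-- Clause (4) of [EtTh] Cor. 2.18 (i) is symmetric: if `γ` stabilises `Ker(Π^tp_X̲̲ → (Π^tp_X)^Θ)` (as an equality of subgroups),
so does `γ⁻¹`. [cite: MochizukiEtTh2009, Cor 2.18 (i) p.60] -/
theorem map_ker_toTheta_comp_subtype_symm (γ : C.Huu ≃ₜ* C.Huu)
    (hK : (D.toTheta.comp C.Huu.subtype).ker.map γ.toMulEquiv.toMonoidHom = (D.toTheta.comp C.Huu.subtype).ker) :
    (D.toTheta.comp C.Huu.subtype).ker.map γ.symm.toMulEquiv.toMonoidHom = (D.toTheta.comp C.Huu.subtype).ker := by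
  have h : (D.toTheta.comp C.Huu.subtype).ker.map γ.symm.toMulEquiv.toMonoidHom =
      ((D.toTheta.comp C.Huu.subtype).ker.map γ.toMulEquiv.toMonoidHom).map γ.symm.toMulEquiv.toMonoidHom := by
    rw [hK]
  have hcomp : γ.symm.toMulEquiv.toMonoidHom.comp γ.toMulEquiv.toMonoidHom = MonoidHom.id _ :=
    MonoidHom.ext fun x => γ.symm_apply_apply x
  rw [h, Subgroup.map_map, hcomp, Subgroup.map_id]

/-- **`γ g ∈ Δ^tp_X ↔ g ∈ Δ^tp_X`** for every admissible `γ` (clause (4)) and every `g ∈ Π^tp_X̲̲` — Δ-stability of `γ` and of `γ⁻¹`,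
bare form. [cite: MochizukiEtTh2009, Cor 2.18 (i) p.60] -/
theorem mem_deltaTemp_apply_iff_of_map_ker_toTheta_eq (γ : C.Huu ≃ₜ* C.Huu)
    (hK : (D.toTheta.comp C.Huu.subtype).ker.map γ.toMulEquiv.toMonoidHom = (D.toTheta.comp C.Huu.subtype).ker)
    (g : C.Huu) : ((γ g : C.Huu) : D.PiTemp) ∈ D.DeltaTemp ↔ (g : D.PiTemp) ∈ D.DeltaTemp := by
  constructor
  · intro h
    have h' := C.aug_apply_eq_one_of_map_ker_toTheta_eq_bare γ.symm (C.map_ker_toTheta_comp_subtype_symm γ hK) (γ g)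
      ((MonoidHom.mem_ker).1 h)
    rw [ContinuousMulEquiv.symm_apply_apply] at h'
    exact (MonoidHom.mem_ker).2 h'
  · intro h
    exact (MonoidHom.mem_ker).2 (C.aug_apply_eq_one_of_map_ker_toTheta_eq_bare γ hK g ((MonoidHom.mem_ker).1 h))

/-- **`γ(Δ_X̲̲) = Δ_X̲̲`** as subgroups of `Π^tp_X̲̲` (`Δ_X̲̲ := Π^tp_X̲̲ ∩ Δ^tp_X`), for EVERY admissible `γ` (clause (4)) of EVERY §1
setting — bare form, no finite-generation hypothesis. [cite: MochizukiEtTh2009, Cor 2.18 (i) p.60] -/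
theorem map_deltaTemp_subgroupOf_eq_of_map_ker_toTheta_eq (γ : C.Huu ≃ₜ* C.Huu)
    (hK : (D.toTheta.comp C.Huu.subtype).ker.map γ.toMulEquiv.toMonoidHom = (D.toTheta.comp C.Huu.subtype).ker) :
    (D.DeltaTemp.subgroupOf C.Huu).map γ.toMulEquiv.toMonoidHom = D.DeltaTemp.subgroupOf C.Huu := by
  ext x
  rw [Subgroup.mem_map]
  constructor
  · rintro ⟨y, hy, rfl⟩
    rw [Subgroup.mem_subgroupOf] at hy ⊢
    exact (C.mem_deltaTemp_apply_iff_of_map_ker_toTheta_eq γ hK y).2 hy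
  · intro hx
    refine ⟨γ.symm x, ?_, γ.apply_symm_apply x⟩
    rw [Subgroup.mem_subgroupOf] at hx ⊢
    have := C.mem_deltaTemp_apply_iff_of_map_ker_toTheta_eq γ hK (γ.symm x)
    rw [ContinuousMulEquiv.apply_symm_apply] at this
    exact this.1 hx

end ThetaSetting.EtaleThetaData.DoubleUnderline

end Literature.AnabelianGeometry.EtaleTheta

end
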